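import Mathlib.MeasureTheory.Integral.Lebesgue.Add
import Literature.Geometry.Riemannian.ChangGurskyYangProofs
import Literature.Geometry.Riemannian.CurvatureDecomposition
import Literature.Geometry.Riemannian.CanonicalNeighbourhoods
import HarnessLib

/-!
# The Weyl energy through Hamilton's blocks, and the "Weyl budget `8π²`" form of the Chang–Gursky–Yang sphere theorem

Topic `Literature/Geometry/Riemannian`. Everything in this file is PROVED (no named fact). It closes
the gap between the tree's named fact `Literature.Geometry.Riemannian.changGurskyYang_sphere_four`
(`ChangGurskyYang.lean`; Chang–Gursky–Yang 2003, Thm. A in the simply connected `scal > 0` case, with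
hypothesis `g.weylEnergy = ∫_M |W_g|² dV_g < 32π²` in the `(0,4)`-norm of `WeylEnergy.lean`) and the
form in which route `SmoothPoincare4/WeylBudget` (assembly item stmt-SmoothPoincare4-3210) consumes the
theorem: the Weyl energy in the `End(Λ²)`-norm, written frame-wise through Hamilton's blocks
`A = g.blockA g.leviCivita x e`, `C = g.blockC g.leviCivita x e` (`CurvatureDecomposition.lean`) as
`w = ¼(‖A − (tr A/3)1‖_F² + ‖C − (tr C/3)1‖_F²)` and integrated against `g.riemVolume`, is `< 8π²`.

## Content

* `WeylBlocks.sum_weylArr_sq_eq_blocksNormSq` — the pointwise algebra: for an algebraic curvature array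
  `R_{ijkl}` on `ℝ⁴` (antisymmetric in each pair, pair-symmetric, first Bianchi identity),
  `Σ_{ijkl} W_{ijkl}² = ‖A − (tr A/3)1‖_F² + ‖C − (tr C/3)1‖_F²`, where `W` is the Weyl array of
  `weylFrame_fin_four` (`W = Rm − ½ E ⊙ δ − (S/24) δ ⊙ δ`, Chang–Gursky–Yang 2003, (0.1)) and `A`, `C`
  are Hamilton's blocks (`A_{ij} = R(φᵢ, φⱼ)`, `C_{ij} = R(ψᵢ, ψⱼ)`, `φ₁ = X₁∧X₂ + X₃∧X₄`, …,
  `R(X∧Y, Z∧W) = R_{XYWZ}`; Hamilton 1997, §1.2). This is Remark 2 of Chang–Gursky–Yang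
  (`|W|²_{(0,4)} = 4‖W‖²_{End(Λ²)}`) combined with `W^± = ½(A − (tr A/3)1)`, `½(C − (tr C/3)1)` in the
  orthonormal bases `φᵢ/√2`, `ψᵢ/√2` of `Λ²_±`; formally it is a polynomial identity in the `21`
  independent components modulo the Bianchi relation (the difference of the two sides is
  `(8/3)(R₀₁₂₃ − R₀₂₁₃ + R₀₃₁₂)²`), verified by normalising the `256`-term sum (`linear_combination`).
* `weylNormSqFrame_eq_hamiltonBlocks` — the same for the frame Weyl tensor of a `C²` metric with its
  Levi-Civita connection in a `g_x`-orthonormal `4`-frame (curvature symmetries: O'Neill 1983,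
  Prop. 3.36; Ricci and scalar curvature as frame contractions, `ChangGurskyYangProofs.lean`).
* `weylNormSq_eq_four_mul`, `weylEnergy_eq_lintegral_four_mul` — hence `|W|²(x) = 4 w(x)` and
  `∫|W|² dV = 4 ∫ w dV_g` (`weylNormSq` is a `⨆` over orthonormal frames of the frame-independent
  quantity; `weylEnergy_eq`, `riemVolume_eq`).
* `changGurskyYang_sphere_four.of_hamiltonBlocks` — **the route form**: `changGurskyYang_sphere_four`
  implies, verbatim, the first hypothesis of `Summit.SmoothPoincare4.SmoothPoincare4.Theses.WeylBudget.Assembly`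
  (compact simply connected smooth `4`-manifold, Riemannian metric with `scal > 0` and
  `∫ ¼(‖A − (tr A/3)1‖² + ‖C − (tr C/3)1‖²) dV_g < 8π²` ⟹ diffeomorphic to `S⁴`), since `4 · 8π² = 32π²`.

## References

* [ChangGurskyYang2003] S.-Y. A. Chang, M. J. Gursky, P. C. Yang, Publ. Math. IHÉS 98 (2003), Thm. A,
  (0.1), Remark 2.
* [Hamilton1997] R. S. Hamilton, Comm. Anal. Geom. 5 (1997), §1.2 (blocks `A, B, C`, bases `φᵢ, ψᵢ`).
* [ONeill1983] B. O'Neill, Semi-Riemannian geometry (1983), Ch. 3, Prop. 3.36 (curvature symmetries).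
* [Besse1987] A. L. Besse, Einstein Manifolds (1987), 1.114–1.117 (`|W|² = |Rm|² − 2|Ric|²/(n−2) + …`).
-/

noncomputable section

open Bundle Finset Module MeasureTheory
open scoped Manifold ContDiff Topology ENNReal

namespace Literature.Geometry.Riemannian

/-! ### The pointwise algebra on curvature arrays -/

namespace WeylBlocks

/-- Ricci contraction of a frame array `R`: `Rc_{ab} = Σᵢ R_{iabi}`. [folklore] -/
def ricArr (R : Fin 4 → Fin 4 → Fin 4 → Fin 4 → ℝ) (a b : Fin 4) : ℝ := ∑ i, R i a b i

/-- Scalar contraction `S = Σᵢ Rc_{ii}`. [folklore] -/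
def scalArr (R : Fin 4 → Fin 4 → Fin 4 → Fin 4 → ℝ) : ℝ := ∑ i, ricArr R i i

/-- The Weyl array in dimension `4` (the formula of `weylFrame_fin_four`). [folklore] -/
def weylArr (R : Fin 4 → Fin 4 → Fin 4 → Fin 4 → ℝ) (i j k l : Fin 4) : ℝ :=
  R i j k l -
    1 / 2 * (ricArr R i l * frameDelta j k + ricArr R j k * frameDelta i l -
      ricArr R i k * frameDelta j l - ricArr R j l * frameDelta i k) +
    scalArr R / 6 * (frameDelta i l * frameDelta j k - frameDelta i k * frameDelta j l)

/-- Index table of Hamilton's self-dual pairs `φ₁ = X₁∧X₂ + X₃∧X₄, …`. [folklore] -/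
def sdIdx : Fin 3 → Fin 2 → Fin 4 × Fin 4 :=
  ![![(0, 1), (2, 3)], ![(0, 2), (3, 1)], ![(0, 3), (1, 2)]]

/-- Index table of Hamilton's anti-self-dual pairs `ψ₁ = X₁∧X₂ + X₄∧X₃, …`. [folklore] -/
def asdIdx : Fin 3 → Fin 2 → Fin 4 × Fin 4 :=
  ![![(0, 1), (3, 2)], ![(0, 2), (1, 3)], ![(0, 3), (2, 1)]]

/-- Table entry `sdIdx 0 0` (by `rfl`). [folklore] -/
@[simp] theorem sdIdx_0_0 : sdIdx 0 0 = (0, 1) := rfl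
/-- Table entry `sdIdx 0 1` (by `rfl`). [folklore] -/
@[simp] theorem sdIdx_0_1 : sdIdx 0 1 = (2, 3) := rfl
/-- Table entry `sdIdx 1 0` (by `rfl`). [folklore] -/
@[simp] theorem sdIdx_1_0 : sdIdx 1 0 = (0, 2) := rfl
/-- Table entry `sdIdx 1 1` (by `rfl`). [folklore] -/
@[simp] theorem sdIdx_1_1 : sdIdx 1 1 = (3, 1) := rfl
/-- Table entry `sdIdx 2 0` (by `rfl`). [folklore] -/
@[simp] theorem sdIdx_2_0 : sdIdx 2 0 = (0, 3) := rfl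
/-- Table entry `sdIdx 2 1` (by `rfl`). [folklore] -/
@[simp] theorem sdIdx_2_1 : sdIdx 2 1 = (1, 2) := rfl
/-- Table entry `asdIdx 0 0` (by `rfl`). [folklore] -/
@[simp] theorem asdIdx_0_0 : asdIdx 0 0 = (0, 1) := rfl
/-- Table entry `asdIdx 0 1` (by `rfl`). [folklore] -/
@[simp] theorem asdIdx_0_1 : asdIdx 0 1 = (3, 2) := rfl
/-- Table entry `asdIdx 1 0` (by `rfl`). [folklore] -/
@[simp] theorem asdIdx_1_0 : asdIdx 1 0 = (0, 2) := rfl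
/-- Table entry `asdIdx 1 1` (by `rfl`). [folklore] -/
@[simp] theorem asdIdx_1_1 : asdIdx 1 1 = (1, 3) := rfl
/-- Table entry `asdIdx 2 0` (by `rfl`). [folklore] -/
@[simp] theorem asdIdx_2_0 : asdIdx 2 0 = (0, 3) := rfl
/-- Table entry `asdIdx 2 1` (by `rfl`). [folklore] -/
@[simp] theorem asdIdx_2_1 : asdIdx 2 1 = (2, 1) := rfl

/-- Block of pairings `Σ_{a,b} R((P i a) ∧, (Q j b))` with `R(X∧Y, Z∧W) = R_{XYWZ}`. [folklore] -/
def blockArr (P Q : Fin 3 → Fin 2 → Fin 4 × Fin 4) (R : Fin 4 → Fin 4 → Fin 4 → Fin 4 → ℝ)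
    (i j : Fin 3) : ℝ :=
  ∑ a, ∑ b, R (P i a).1 (P i a).2 (Q j b).2 (Q j b).1

/-- The Frobenius sum `‖A − (tr A/3)1‖² + ‖C − (tr C/3)1‖²` of the arrays. [folklore] -/
def blocksNormSq (R : Fin 4 → Fin 4 → Fin 4 → Fin 4 → ℝ) : ℝ :=
  ∑ i, ∑ j,
    ((blockArr sdIdx sdIdx R i j - (∑ k, blockArr sdIdx sdIdx R k k) / 3 * frameDelta i j) ^ 2 +
      (blockArr asdIdx asdIdx R i j - (∑ k, blockArr asdIdx asdIdx R k k) / 3 * frameDelta i j) ^ 2)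

set_option maxHeartbeats 4000000 in
set_option maxRecDepth 100000 in
/-- **`Σ W² = ‖A − (trA/3)1‖² + ‖C − (trC/3)1‖²`** for an algebraic curvature array. [folklore] -/
theorem sum_weylArr_sq_eq_blocksNormSq (R : Fin 4 → Fin 4 → Fin 4 → Fin 4 → ℝ)
    (h12 : ∀ a b c d, R a b c d = -R b a c d) (h34 : ∀ a b c d, R a b c d = -R a b d c)
    (hp : ∀ a b c d, R a b c d = R c d a b)
    (hb : R 0 1 2 3 + R 1 2 0 3 + R 2 0 1 3 = 0) :
    ∑ i, ∑ j, ∑ k, ∑ l, weylArr R i j k l ^ 2 = blocksNormSq R := by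
  have hz12 : ∀ a c d, R a a c d = 0 := fun a c d ↦ by have := h12 a a c d; linarith
  have hz34 : ∀ a b c, R a b c c = 0 := fun a b c ↦ by have := h34 a b c c; linarith
  have hd4 : ∀ a b : Fin 4, a ≠ b → frameDelta a b = 0 := fun a b h ↦ frameDelta_of_ne h
  have hd3 : ∀ a b : Fin 3, a ≠ b → frameDelta a b = 0 := fun a b h ↦ frameDelta_of_ne h
  have hL : R 0 1 2 3 - R 0 2 1 3 + R 0 3 1 2 = 0 := by
    have := hb
    rw [hp 1 2 0 3, h12 2 0] at this
    linarith
  simp only [weylArr, ricArr, scalArr, blocksNormSq, blockArr, Fin.sum_univ_four,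
    Fin.sum_univ_three, Fin.sum_univ_two, Fin.isValue, sdIdx_0_0, sdIdx_0_1, sdIdx_1_0, sdIdx_1_1, sdIdx_2_0, sdIdx_2_1, asdIdx_0_0, asdIdx_0_1, asdIdx_1_0, asdIdx_1_1, asdIdx_2_0, asdIdx_2_1, frameDelta_self, hd4 0 1 (by decide), hd4 0 2 (by decide), hd4 0 3 (by decide), hd4 1 0 (by decide), hd4 1 2 (by decide), hd4 1 3 (by decide), hd4 2 0 (by decide), hd4 2 1 (by decide), hd4 2 3 (by decide), hd4 3 0 (by decide), hd4 3 1 (by decide), hd4 3 2 (by decide), hd3 0 1 (by decide), hd3 0 2 (by decide), hd3 1 0 (by decide), hd3 1 2 (by decide), hd3 2 0 (by decide), hd3 2 1 (by decide)]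
  simp only [hz12, hz34, h12 1 0, h12 2 0, h12 2 1, h12 3 0, h12 3 1, h12 3 2, fun a b => h34 a b 1 0, fun a b => h34 a b 2 0, fun a b => h34 a b 2 1, fun a b => h34 a b 3 0, fun a b => h34 a b 3 1, fun a b => h34 a b 3 2, hp 0 2 0 1, hp 0 3 0 1, hp 0 3 0 2, hp 1 2 0 1, hp 1 2 0 2, hp 1 2 0 3, hp 1 3 0 1, hp 1 3 0 2, hp 1 3 0 3, hp 1 3 1 2, hp 2 3 0 1, hp 2 3 0 2, hp 2 3 0 3, hp 2 3 1 2, hp 2 3 1 3]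
  linear_combination (8 / 3 : ℝ) * (R 0 1 2 3 - R 0 2 1 3 + R 0 3 1 2) * hL

end WeylBlocks

/-! ### The frame Weyl tensor and Hamilton's blocks of a metric -/

section Geometry

open Literature.Geometry.Lorentzian (PseudoRiemannianMetric)
open Literature.Geometry.Lorentzian.PseudoRiemannianMetric

variable {E : Type*} [NormedAddCommGroup E] [NormedSpace ℝ E] {H : Type*} [TopologicalSpace H]
  {I : ModelWithCorners ℝ E H} {M : Type*} [TopologicalSpace M] [ChartedSpace H M]
  [IsManifold I ∞ M] {n : ℕ∞ω}

variable (g : PseudoRiemannianMetric I n E (TangentSpace I : M → Type _))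

omit [IsManifold I ∞ M] in
/-- Hamilton's self-dual pair lists are the frame values at the index table `WeylBlocks.sdIdx`.
[cite: Hamilton1997, §1.2, p. 5] -/
theorem selfDualPairs_eq_sdIdx {x : M} (e : Fin 4 → TangentSpace I x) (i : Fin 3) (a : Fin 2) :
    selfDualPairs e i a = (e (WeylBlocks.sdIdx i a).1, e (WeylBlocks.sdIdx i a).2) := by
  fin_cases i <;> fin_cases a <;> rfl

omit [IsManifold I ∞ M] in
/-- Hamilton's anti-self-dual pair lists are the frame values at `WeylBlocks.asdIdx`.
[cite: Hamilton1997, §1.2, p. 5] -/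
theorem antiSelfDualPairs_eq_asdIdx {x : M} (e : Fin 4 → TangentSpace I x) (i : Fin 3) (a : Fin 2) :
    antiSelfDualPairs e i a = (e (WeylBlocks.asdIdx i a).1, e (WeylBlocks.asdIdx i a).2) := by
  fin_cases i <;> fin_cases a <;> rfl

variable (cov : CovariantDerivative I E (TangentSpace I : M → Type _))

/-- `A_{ij}` is the array block of the frame components `R_{abcd} = Rm(e_a, e_b, e_c, e_d)`.
[cite: Hamilton1997, §1.2, pp. 4–5] -/
theorem blockA_eq_blockArr {x : M} (e : Fin 4 → TangentSpace I x) (i j : Fin 3) :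
    g.blockA cov x e i j =
      WeylBlocks.blockArr WeylBlocks.sdIdx WeylBlocks.sdIdx
        (fun a b c d ↦ g.curvatureForm cov x (e a) (e b) (e c) (e d)) i j := by
  simp only [blockA, Matrix.of_apply, pairingCurvature, bivectorCurvature, WeylBlocks.blockArr,
    selfDualPairs_eq_sdIdx]

/-- `C_{ij}` is the array block of the frame components. [cite: Hamilton1997, §1.2, pp. 4–5] -/
theorem blockC_eq_blockArr {x : M} (e : Fin 4 → TangentSpace I x) (i j : Fin 3) :
    g.blockC cov x e i j =
      WeylBlocks.blockArr WeylBlocks.asdIdx WeylBlocks.asdIdx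
        (fun a b c d ↦ g.curvatureForm cov x (e a) (e b) (e c) (e d)) i j := by
  simp only [blockC, Matrix.of_apply, pairingCurvature, bivectorCurvature, WeylBlocks.blockArr,
    antiSelfDualPairs_eq_asdIdx]

variable [FiniteDimensional ℝ E] [g.HasLeviCivita]

/-- In an orthonormal `4`-frame the frame Weyl tensor is the Weyl array of the frame components
of `Rm` (Ricci and scalar curvature being frame contractions). [cite: ChangGurskyYang2003, (0.1)] -/
theorem weylFrame_eq_weylArr (hE : finrank ℝ E = 4) {x : M} {e : Fin 4 → TangentSpace I x}
    (he : g.IsOrthonormalFrame x e) (i j k l : Fin 4) :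
    g.weylFrame x e i j k l =
      WeylBlocks.weylArr (fun a b c d ↦ g.curvatureForm g.leviCivita x (e a) (e b) (e c) (e d))
        i j k l := by
  simp only [weylFrame_fin_four, WeylBlocks.weylArr, WeylBlocks.ricArr, WeylBlocks.scalArr, frameDelta,
    he.sum_curvatureForm_eq_ricci g hE, he.sum_ricci_eq_scalarCurvature g hE]

variable [Fact (1 ≤ n)] [CompleteSpace E]

/-- **`|W|² = ‖A − (tr A/3)1‖_F² + ‖C − (tr C/3)1‖_F²` in an orthonormal `4`-frame** of a `C²`
metric with its Levi-Civita connection: the `(0,4)`-norm `Σ W_{ijkl}²` (`weylNormSqFrame`) equals the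
Frobenius sum for Hamilton's blocks (`= 4‖W‖²_{End(Λ²)}`, Chang–Gursky–Yang 2003, Remark 2).
[cite: ChangGurskyYang2003, Thm. A, Remark 2] [cite: Hamilton1997, §1.2] -/
theorem weylNormSqFrame_eq_hamiltonBlocks (hn : 2 ≤ n) (hE : finrank ℝ E = 4) {x : M}
    {e : Fin 4 → TangentSpace I x} (he : g.IsOrthonormalFrame x e) :
    g.weylNormSqFrame x e =
      ∑ i : Fin 3, ∑ j : Fin 3,
        (((g.blockA g.leviCivita x e -
              ((g.blockA g.leviCivita x e).trace / 3) • (1 : Matrix (Fin 3) (Fin 3) ℝ)) i j) ^ 2 +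
          ((g.blockC g.leviCivita x e -
              ((g.blockC g.leviCivita x e).trace / 3) • (1 : Matrix (Fin 3) (Fin 3) ℝ)) i j) ^ 2) := by
  have hLC : g.IsLeviCivita g.leviCivita := isLeviCivita_leviCivita_holds
  set R : Fin 4 → Fin 4 → Fin 4 → Fin 4 → ℝ :=
    fun a b c d ↦ g.curvatureForm g.leviCivita x (e a) (e b) (e c) (e d) with hR
  have h12 : ∀ a b c d, R a b c d = -R b a c d :=
    fun a b c d ↦ g.curvatureForm_antisymm g.leviCivita x (e a) (e b) (e c) (e d)
  have h34 : ∀ a b c d, R a b c d = -R a b d c :=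
    fun a b c d ↦ g.curvatureForm_leviCivita_antisymm₃₄ hn x (e a) (e b) (e c) (e d)
  have hp : ∀ a b c d, R a b c d = R c d a b :=
    fun a b c d ↦ hLC.val_curvature_pair_symm hn x (e a) (e b) (e c) (e d)
  have hb : R 0 1 2 3 + R 1 2 0 3 + R 2 0 1 3 = 0 := hLC.val_curvature_cyclic hn x (e 0) (e 1) (e 2) (e 3)
  have key := WeylBlocks.sum_weylArr_sq_eq_blocksNormSq R h12 h34 hp hb
  have hW : ∀ i j k l, g.weylFrame x e i j k l = WeylBlocks.weylArr R i j k l :=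
    weylFrame_eq_weylArr g hE he
  have hA : ∀ i j, g.blockA g.leviCivita x e i j = WeylBlocks.blockArr WeylBlocks.sdIdx WeylBlocks.sdIdx R i j :=
    blockA_eq_blockArr g g.leviCivita e
  have hC : ∀ i j, g.blockC g.leviCivita x e i j = WeylBlocks.blockArr WeylBlocks.asdIdx WeylBlocks.asdIdx R i j :=
    blockC_eq_blockArr g g.leviCivita e
  rw [weylNormSqFrame]
  simp only [hW, key, WeylBlocks.blocksNormSq, Matrix.sub_apply, Matrix.smul_apply, Matrix.one_apply,
    Matrix.trace, Matrix.diag_apply, smul_eq_mul, hA, hC, frameDelta, mul_ite, mul_one, mul_zero]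

omit [Fact (1 ≤ n)] [CompleteSpace E] in
/-- The frame sum `Σ W²` is invariant under reindexing the frame along an equivalence.
[folklore] -/
theorem weylNormSqFrame_comp_equiv {ι ι' : Type*} [Fintype ι] [DecidableEq ι] [Fintype ι']
    [DecidableEq ι'] {x : M} (e : ι' → TangentSpace I x) (σ : ι ≃ ι') :
    g.weylNormSqFrame x (e ∘ σ) = g.weylNormSqFrame x e := by
  unfold weylNormSqFrame
  have hcard : (Fintype.card ι : ℝ) = Fintype.card ι' := by exact_mod_cast Fintype.card_congr σ
  have hentry : ∀ i j k l : ι, g.weylFrame x (e ∘ σ) i j k l = g.weylFrame x e (σ i) (σ j) (σ k) (σ l) := by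
    intro i j k l
    simp only [weylFrame_apply, Function.comp_apply, hcard, σ.injective.eq_iff]
  simp only [hentry]
  exact σ.sum_comp (fun i ↦ ∑ j, ∑ k, ∑ l, g.weylFrame x e i (σ j) (σ k) (σ l) ^ 2) |>.trans
    (Finset.sum_congr rfl fun i _ ↦ σ.sum_comp (fun j ↦ ∑ k, ∑ l, g.weylFrame x e i j (σ k) (σ l) ^ 2)
      |>.trans (Finset.sum_congr rfl fun j _ ↦ σ.sum_comp (fun k ↦ ∑ l, g.weylFrame x e i j k (σ l) ^ 2)
        |>.trans (Finset.sum_congr rfl fun k _ ↦ σ.sum_comp (fun l ↦ g.weylFrame x e i j k l ^ 2))))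

/-- **`|W_g|²(x) = 4 w(x)`**: if `w(x)` is given in EVERY orthonormal `4`-frame by
`¼(‖A − (tr A/3)1‖² + ‖C − (tr C/3)1‖²)`, then the pointwise `(0,4)`-norm `weylNormSq` (a `⨆` over
the — nonempty, `g` Riemannian — orthonormal frames of the frame-independent `Σ W²`) is `4 w(x)`.
[cite: ChangGurskyYang2003, Thm. A, Remark 2] -/
theorem weylNormSq_eq_four_mul (hn : 2 ≤ n) (hE : finrank ℝ E = 4) (hg : g.IsRiemannian) {w : M → ℝ}
    (hw : ∀ (x : M) (e : Fin 4 → TangentSpace I x), g.IsOrthonormalFrame x e →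
      w x = (1 / 4 : ℝ) * ∑ i : Fin 3, ∑ j : Fin 3,
        (((g.blockA g.leviCivita x e -
              ((g.blockA g.leviCivita x e).trace / 3) • (1 : Matrix (Fin 3) (Fin 3) ℝ)) i j) ^ 2 +
          ((g.blockC g.leviCivita x e -
              ((g.blockC g.leviCivita x e).trace / 3) • (1 : Matrix (Fin 3) (Fin 3) ℝ)) i j) ^ 2))
    (x : M) : g.weylNormSq x = 4 * w x := by
  set σ : Fin 4 ≃ Fin (finrank ℝ E) := finCongr hE.symm with hσ
  have hval : ∀ e' : {e : Fin (finrank ℝ E) → TangentSpace I x // g.IsOrthonormalFrame x e},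
      g.weylNormSqFrame x e'.1 = 4 * w x := by
    intro e'
    have he : g.IsOrthonormalFrame x (e'.1 ∘ σ) := e'.2.comp σ.injective
    rw [← weylNormSqFrame_comp_equiv g e'.1 σ, weylNormSqFrame_eq_hamiltonBlocks g hn hE he,
      hw x _ he]
    ring
  obtain ⟨b, hb⟩ := g.exists_basis_isOrthonormalFrame (x := x) (hg x) rfl
  haveI : Nonempty {e : Fin (finrank ℝ E) → TangentSpace I x // g.IsOrthonormalFrame x e} :=
    ⟨⟨b, hb⟩⟩
  unfold weylNormSq
  simp only [hval, ciSup_const]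

/-- **`∫_M |W_g|² dV_g = 4 ∫_M w dV_g`** for such a `w`, with the tree's Riemannian volume measure
`g.riemVolume`. [cite: ChangGurskyYang2003, (0.3)] -/
theorem weylEnergy_eq_lintegral_four_mul [T2Space M] [T3Space M] [MeasurableSpace M] [BorelSpace M]
    (hn : 2 ≤ n) (hE : finrank ℝ E = 4) (hg : g.IsRiemannian) {w : M → ℝ}
    (hw : ∀ (x : M) (e : Fin 4 → TangentSpace I x), g.IsOrthonormalFrame x e →
      w x = (1 / 4 : ℝ) * ∑ i : Fin 3, ∑ j : Fin 3,
        (((g.blockA g.leviCivita x e -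
              ((g.blockA g.leviCivita x e).trace / 3) • (1 : Matrix (Fin 3) (Fin 3) ℝ)) i j) ^ 2 +
          ((g.blockC g.leviCivita x e -
              ((g.blockC g.leviCivita x e).trace / 3) • (1 : Matrix (Fin 3) (Fin 3) ℝ)) i j) ^ 2)) :
    g.weylEnergy = ENNReal.ofReal 4 * ∫⁻ x, ENNReal.ofReal (w x) ∂g.riemVolume := by
  rw [g.weylEnergy_eq hg, ← g.riemVolume_eq hg, ← lintegral_const_mul' _ _ ENNReal.ofReal_ne_top]
  refine lintegral_congr fun x ↦ ?_
  rw [weylNormSq_eq_four_mul g hn hE hg hw x, ENNReal.ofReal_mul (by norm_num)]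

end Geometry

/-! ### The route form of the Chang–Gursky–Yang sphere theorem ("Weyl budget `8π²`") -/

/-- **Chang–Gursky–Yang 2003, Thm. A, in the form consumed by route `SmoothPoincare4/WeylBudget`**
(verbatim the first hypothesis of its assembly, stmt-SmoothPoincare4-3210): given the tree's named
fact `changGurskyYang_sphere_four` (Weyl energy `< 32π²` in the `(0,4)`-norm), every compact simply
connected smooth `4`-manifold carrying a Riemannian metric of positive scalar curvature whose Weyl
energy in the `End(Λ²)`-norm — the function `w = ¼(‖A − (tr A/3)1‖_F² + ‖C − (tr C/3)1‖_F²)` of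
Hamilton's blocks in orthonormal frames — has `∫ w dV_g < 8π²`, is diffeomorphic to `S⁴`
(`∫|W|² dV = 4 ∫ w dV < 32π²`, `weylEnergy_eq_lintegral_four_mul`; Remark 2: `|W|² = 4‖W‖²`).
[cite: ChangGurskyYang2003, Thm. A, Remark 2] -/
theorem changGurskyYang_sphere_four.of_hamiltonBlocks (h : changGurskyYang_sphere_four) :
    ∀ (M : Type) [TopologicalSpace M] [T2Space M] [SecondCountableTopology M]
      [ChartedSpace (EuclideanSpace ℝ (Fin 4)) M] [IsManifold (𝓡 4) ∞ M] [CompactSpace M]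
      [SimplyConnectedSpace M] [T3Space M] [MeasurableSpace M] [BorelSpace M],
      (∃ g : Literature.Geometry.Lorentzian.PseudoRiemannianMetric (𝓡 4) ∞ (EuclideanSpace ℝ (Fin 4))
          (TangentSpace (𝓡 4) : M → Type _),
        ∃ _ : g.HasLeviCivita, g.IsRiemannian ∧ (∀ x, 0 < g.scalarCurvature x) ∧
          ∃ w : M → ℝ,
            (∀ (x : M) (e : Fin 4 → TangentSpace (𝓡 4) x), g.IsOrthonormalFrame x e →
              w x = (1 / 4 : ℝ) * ∑ i : Fin 3, ∑ j : Fin 3,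
                (((g.blockA g.leviCivita x e -
                      ((g.blockA g.leviCivita x e).trace / 3) • (1 : Matrix (Fin 3) (Fin 3) ℝ)) i j) ^ 2 +
                  ((g.blockC g.leviCivita x e -
                      ((g.blockC g.leviCivita x e).trace / 3) • (1 : Matrix (Fin 3) (Fin 3) ℝ)) i j) ^ 2)) ∧
            ∫⁻ x, ENNReal.ofReal (w x) ∂g.riemVolume < ENNReal.ofReal (8 * Real.pi ^ 2)) →
        Nonempty (M ≃ₘ⟮𝓡 4, 𝓡 4⟯ (Metric.sphere (0 : EuclideanSpace ℝ (Fin 5)) 1)) := by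
  intro M _ _ _ _ _ _ _ _ _ _ hM
  obtain ⟨g, hLC, hg, hscal, w, hw, hint⟩ := hM
  haveI : Fact ((1 : ℕ∞ω) ≤ ((⊤ : ℕ∞) : ℕ∞ω)) := ⟨WithTop.coe_le_coe.mpr le_top⟩
  refine h M ⟨g, hLC, hg, hscal, ?_⟩
  rw [weylEnergy_eq_lintegral_four_mul g (WithTop.coe_le_coe.mpr le_top) finrank_euclideanSpace_fin hg hw]
  calc ENNReal.ofReal 4 * ∫⁻ x, ENNReal.ofReal (w x) ∂g.riemVolume
      < ENNReal.ofReal 4 * ENNReal.ofReal (8 * Real.pi ^ 2) :=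
        ENNReal.mul_right_strictMono (by norm_num) ENNReal.ofReal_ne_top hint
    _ = ENNReal.ofReal (32 * Real.pi ^ 2) := by
        rw [← ENNReal.ofReal_mul (by norm_num)]; ring_nf

end Literature.Geometry.Riemannian

end
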